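import Summits.QuantumFields.BalabanUV.T4Continuum.Support.ShellMeasureLandauCorrectionFromQ
import Summits.QuantumFields.BalabanUV.T4Continuum.Support.ShellMeasureLinearizedGammaTEnd
import Summits.QuantumFields.BalabanUV.T4Continuum.Support.ShellMeasureAverageIterateEnd

/-!
# `T4Continuum.ShellMeasureLandauCorrectionIterate` — W-a (Cf) INTO END-II, file 2∕2: THE PRINTED `k`-FOLD AVERAGE (15)
# over the pyramid, FROM PRINT'S (52) + UNITARITY ALONE — END-II's three Landau-correction binders `hCd` ∕ `hCq` ∕ `hCr`
# for `Cf := landauCf (chartIter … k) R_k` and B11 Sect. C's correction `D` along every holomorphic curve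
# (constants `k`-DEPENDENT — said so; the `k`-uniform road is rows S55∕S56)
(cell `pub-balaban`, sub-cell `t4`, spine estimate NE7c (node U5b); NE7c ROUND-2 crew `t4-ne7c-formalise-*`, unit
`b2b-balaban-t4-ne7c-formalise-leaf-08` gen 11; an UNBOOKED COMPANION of owner table v2.7 row S64 (leaf-04-g4: the `k`-UNIFORM
pair in b07 typing) — journal l.14614 ∕ l.14830 ∕ l.14923; ADDITIVE — imports file 1 `ShellMeasureLandauCorrectionFromQ` (generic
half), this lineage's S52 f2 `ShellMeasureLinearizedGammaTEnd` (p219653: (Q4) `QtΓ_conj`) and S57 f3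
`ShellMeasureAverageIterateEnd` (p220136: the chart iterate from (52)) ONLY; 0 `def`, 0 `def … : Prop`, 0 sorry, 0 cite tags)

HONEST FRAMING.  Finite four-torus programme, rung (B)+1 only — NOT infinite volume, NOT a mass gap, NOT the Clay
problem, NOT summit progress; (B), `BetaPertHyp`, (B^μ) are not consumed.  NE7c (`T4IndicatorShell.ShellWeightBound`) is
NOT PRINTED and NOT PROVED; «NE7c ⇐ the named binders».  ELEMENTARY + JUNCTIONS BY NAME ([folklore]); nothing printed is
asserted or cited ([Balaban1985Averaging] (52) enters through b07's KERNEL Prop. 2 via S59∕S57 f3).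

WHAT THIS FILE PROVES (kernel, 0 sorry) — for the chart iterate `chartIter L T (avgIter L U₀) k` (S57) of the printed
one-step average [B7] (15) = [B12] (2.4) over a pyramid `T` of finite bond regions (`qppBonds L c ⊆ T j` for `c ∈ T (j+1)`),
at a background `U₀` valued in an averaging-closed gauge group `G` with print's (52) `pdev U₀ < α₀L^{−2k}`, `C₀α₀ ≤ ⅓`,
`2α₀ ≤ c₂′`, `2 ≤ L`; radius `R_k = M⁻¹∕Mᵏ`, `M = 2816(d+1)L`:
* §1 `hCd` ∕ `hCq` ∕ `0 ≤ C₂` (`cf_chartIter_differentiableOn`, `cf_chartIter_sq_bound`, `cf_chartIter_C₂_nonneg`) with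
  `C₂ = Mq R_k (Mᵏ·R_k)` — (Q1)–(Q3) are S57 f3's `chartIter_analyticOnNhd_of_prop2` ∕ `chartIter_zero` ∕
  `norm_chartIter_le_of_prop2` BY NAME, fed to file 1; and file 1 §2 FIRED: `landauCorrection_chartIter` — B11 Sect. C's
  Landau correction EXISTS along every holomorphic curve for THIS `Cf`, given (46)-type `H`, `ι`, (54)-smallness.
* §2 ⋆-EQUIVARIANCE and `hCr` (for `G = U(𝔸)`, `𝔸` a C⋆-algebra — print's `U(N)`): `iterMap_conj_of_lt` (generic:
  equivariant analytic level maps compose to an equivariant iterate on the shrinking ball), `chartStep_star` (S52 f2's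
  (Q4) `QtΓ_conj` per coarse bond under block locality), `avgIter_mem_unitary` (S59 `mem_level` at `U(𝔸)`),
  **`chartIter_star`** (`chartIter … k (B⋆) = (chartIter … k B)⋆` on `ball 0 R_k`), **`cf_chartIter_mem_realSub`** — END-II's
  `hCr` for the HERMITIAN real forms (S40 `realSub` of the componentwise `⋆`; the b12 typing `exp(I•B′)·V`).
HONEST DIFFERENCES, DISPLAYED: (i) `R_k`, `C₂` depend on `k` (crude one-step bound); print's `k`-UNIFORM `C₂ = e^{O(1)2α₀}8C₁`
([B7] (135)) = row S64 (leaf-04-g4, from S56 f3) — in b07 typing; in THIS typing it is ONE MORE CALL of file 1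
(`norm_landauCf_le_of_sq_bound`) once the b07↔b12 log-chart dictionary is written; (ii) the real structure
here is the Hermitian one of the b12 typing; the LD line's skew-adjoint convention differs by the `I•` dictionary ([dict]);
(iii) B11 uses `C_j` SECTIONED with V-uniform constants and with `H` = [5] Thm 3.12 — displayed (W-a).  NOTHING in the
countdown moves.  HONEST DEPENDENCY (cell): continuum YM on T⁴ ⇐ BetaPertH ∧ nine spine estimates (0/9 proved); BetaPertH
⇐ (D1) ∧ (D4) ∧ CAP+tail; G-an2-4 gates asym, D1 and NE2/3/4.
-/

noncomputable section

open Set Metric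

namespace Summit.QuantumFields.BalabanUV.T4Continuum.ShellMeasureLandauCorrectionIterate

open Literature.MathematicalPhysics.QuantumFieldTheory.Balaban1983to89
open Literature.MathematicalPhysics.QuantumLattice (ZdEdge)
open B7BlockGeometry (qppBonds)
open B7Prop2Explicit (pdev C0 c2' AvgClosed unitaryUnits mem_unitaryUnits avgClosed_unitaryUnits)
open B12HOperator267 (gammaT)
open B12AverageCorridor267 (Qtilde loopW offAxis)
open Summit.QuantumFields.BalabanUV.Beta.LinearizingChange267FromQ (nonlin Mq)
open ShellMeasureLinearizedRealStructure (realSub mem_realSub)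
open ShellMeasureLinearizedGammaT (QtΓ κΓ κ𝔸 QtΓ_conj)
open ShellMeasureLandauCorrectionFromQ (landauCf differentiableOn_landauCf norm_landauCf_le_sq C₂_nonneg
  landauCf_mem_realSub landauCorrection_along_of_Q)
open ShellMeasureAverageIterate (iterMap iterMap_zero iterMap_succ restr restr_apply norm_restr_le Qtilde_ext_eq_of_subset
  chartStep chartStep_zero chartStep_analyticOnNhd norm_chartStep_le chartIter chartIter_zero chartIter_zero_apply
  chartIter_succ_apply)
open ShellMeasureAverageIteratePower (avgIter)
open ShellMeasureAverageIterateEnd (iterMap_facts_of_lt avgIter_eq_uncurry regime_of_prop2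
  chartIter_analyticOnNhd_of_prop2 norm_chartIter_le_of_prop2)
open ShellMeasureAverageIterateRegular (mem_level)

/-! ## §1 `hCd` ∕ `hCq` for the printed `k`-fold average over the pyramid, from print's (52) alone; B11 Sect. C fired -/

section Printed

variable {d : ℕ} {𝔸 : Type*} [NormedRing 𝔸] [NormOneClass 𝔸] [NormedAlgebra ℂ 𝔸] [CompleteSpace 𝔸] {L : ℕ}
  {T : ℕ → Finset (ZdEdge d)}
  (hL : 2 ≤ L) (hT : ∀ j, ∀ c ∈ T (j + 1), qppBonds L c ⊆ T j) {G : Subgroup 𝔸ˣ} (hG : AvgClosed d L G)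
  (k : ℕ) (U₀ : ZdEdge d → 𝔸ˣ) (hU : ∀ b, U₀ b ∈ G) {α₀ : ℝ} (hα : 0 < α₀) (hα3 : C0 d * α₀ ≤ 1 / 3)
  (hα2 : 2 * α₀ ≤ c2' d L) (h52 : pdev (Function.curry U₀) < α₀ * (((L : ℝ) ^ k)⁻¹) ^ 2)

/-- the radius `R_k = M⁻¹∕Mᵏ`, `M = 2816(d+1)L`, of S57's chart iterate is positive. [folklore] -/
theorem Rk_pos (hL : 2 ≤ L) (k : ℕ) :
    0 < 1 / (2816 * ((d : ℝ) + 1) * L) / (2816 * ((d : ℝ) + 1) * L) ^ k := by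
  have hL' : (0 : ℝ) < L := by exact_mod_cast lt_of_lt_of_le (by norm_num) hL
  positivity

include hL hT hG hU hα hα3 hα2 h52

/-- (Q3) FOR THE CHART ITERATE in END-II's currency: on `ball 0 R_k`, `‖chartIter … k B‖ ≤ Mᵏ·R_k` (S57 f3
`norm_chartIter_le_of_prop2`: `≤ Mᵏ‖B‖`, and `‖B‖ < R_k`). [folklore] -/
theorem norm_chartIter_le_MQ :
    ∀ B ∈ ball (0 : ↥(T 0) → 𝔸) (1 / (2816 * ((d : ℝ) + 1) * L) / (2816 * ((d : ℝ) + 1) * L) ^ k),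
      ‖chartIter L T (avgIter L U₀) k B‖ ≤
        (2816 * ((d : ℝ) + 1) * L) ^ k * (1 / (2816 * ((d : ℝ) + 1) * L) / (2816 * ((d : ℝ) + 1) * L) ^ k) := by
  intro B hB
  refine (norm_chartIter_le_of_prop2 hL hT hG k U₀ hU hα hα3 hα2 h52 hB).trans ?_
  exact mul_le_mul_of_nonneg_left (mem_ball_zero_iff.1 hB).le (by positivity)

/-- **END-II's `hCd` FOR THE PRINTED `k`-FOLD AVERAGE, FROM (52) ALONE**: the Landau-correction map read off the chart
iterate `chartIter L T (avgIter L U₀) k` is complex-differentiable on `ball 0 R_k`. [folklore] -/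
theorem cf_chartIter_differentiableOn :
    DifferentiableOn ℂ
      (landauCf (chartIter L T (avgIter L U₀) k) (1 / (2816 * ((d : ℝ) + 1) * L) / (2816 * ((d : ℝ) + 1) * L) ^ k))
      (ball (0 : ↥(T 0) → 𝔸) (1 / (2816 * ((d : ℝ) + 1) * L) / (2816 * ((d : ℝ) + 1) * L) ^ k)) :=
  differentiableOn_landauCf (chartIter_analyticOnNhd_of_prop2 hL hT hG k U₀ hU hα hα3 hα2 h52)

/-- **END-II's `hCq` FOR THE PRINTED `k`-FOLD AVERAGE, FROM (52) ALONE**: `‖Cf Z‖ ≤ C₂‖Z‖²` on `‖Z‖ < R_k` with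
`C₂ = Mq R_k (Mᵏ·R_k) = 2Mᵏ∕R_k` — a `k`-DEPENDENT constant (honest difference vs [B7] (135)'s `k`-uniform `C₂`, header).
[folklore] -/
theorem cf_chartIter_sq_bound :
    ∀ Z : ↥(T 0) → 𝔸, ‖Z‖ < 1 / (2816 * ((d : ℝ) + 1) * L) / (2816 * ((d : ℝ) + 1) * L) ^ k →
      ‖landauCf (chartIter L T (avgIter L U₀) k)
          (1 / (2816 * ((d : ℝ) + 1) * L) / (2816 * ((d : ℝ) + 1) * L) ^ k) Z‖ ≤
        Mq (1 / (2816 * ((d : ℝ) + 1) * L) / (2816 * ((d : ℝ) + 1) * L) ^ k)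
          ((2816 * ((d : ℝ) + 1) * L) ^ k * (1 / (2816 * ((d : ℝ) + 1) * L) / (2816 * ((d : ℝ) + 1) * L) ^ k)) *
        ‖Z‖ ^ 2 :=
  norm_landauCf_le_sq (Rk_pos hL k) (chartIter_analyticOnNhd_of_prop2 hL hT hG k U₀ hU hα hα3 hα2 h52)
    (norm_chartIter_le_MQ hL hT hG k U₀ hU hα hα3 hα2 h52) (chartIter_zero k)

/-- END-II's `hC₂ : 0 ≤ C₂` for that constant. [folklore] -/
theorem cf_chartIter_C₂_nonneg :
    0 ≤ Mq (1 / (2816 * ((d : ℝ) + 1) * L) / (2816 * ((d : ℝ) + 1) * L) ^ k)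
      ((2816 * ((d : ℝ) + 1) * L) ^ k * (1 / (2816 * ((d : ℝ) + 1) * L) / (2816 * ((d : ℝ) + 1) * L) ^ k)) :=
  C₂_nonneg (Rk_pos hL k) (norm_chartIter_le_MQ hL hT hG k U₀ hU hα hα3 hα2 h52)

/-- **B11 SECT. C's LANDAU CORRECTION EXISTS FOR THE PRINTED `k`-FOLD AVERAGE, FROM (52) ALONE** (file 1 §2 fired): for the
scaling `ι` into the level-0 bond fields of the pyramid, an operator `H` from the level-`k` bond fields with (46)-TYPE bound
`B₀`, the (54)-TYPE smallness `9·C₂·B₀·ε < 1` at THIS file's `C₂` and `3ε ≤ R_k`, along any holomorphic curve of fields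
`‖Y_σ‖ < ε`: the correction `σ ↦ D_σ` of (50) exists, is holomorphic, unique in its ball, and obeys (55). [folklore] -/
theorem landauCorrection_chartIter {𝒴 : Type*} [NormedAddCommGroup 𝒴] [NormedSpace ℂ 𝒴]
    (ι : 𝒴 →L[ℂ] (↥(T 0) → 𝔸)) (hι : ∀ Y, ‖ι Y‖ ≤ ‖Y‖) (H : (↥(T k) → 𝔸) →L[ℂ] 𝒴) {B₀ : ℝ} (hB₀ : 0 ≤ B₀)
    (hH : ∀ X, ‖H X‖ ≤ B₀ * ‖X‖) {ε Rad : ℝ}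
    (hq : 9 * Mq (1 / (2816 * ((d : ℝ) + 1) * L) / (2816 * ((d : ℝ) + 1) * L) ^ k)
      ((2816 * ((d : ℝ) + 1) * L) ^ k * (1 / (2816 * ((d : ℝ) + 1) * L) / (2816 * ((d : ℝ) + 1) * L) ^ k)) *
      B₀ * ε < 1)
    (hRC : 3 * ε ≤ 1 / (2816 * ((d : ℝ) + 1) * L) / (2816 * ((d : ℝ) + 1) * L) ^ k)
    {Y : ℂ → 𝒴} (hYd : DifferentiableOn ℂ Y (ball 0 Rad)) (hY : ∀ σ ∈ ball (0 : ℂ) Rad, ‖Y σ‖ < ε) :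
    let R := 1 / (2816 * ((d : ℝ) + 1) * L) / (2816 * ((d : ℝ) + 1) * L) ^ k
    let C₂ := Mq R ((2816 * ((d : ℝ) + 1) * L) ^ k * R)
    let Cf := landauCf (chartIter L T (avgIter L U₀) k) R
    ∃ Dc : ℂ → (↥(T k) → 𝔸), DifferentiableOn ℂ Dc (ball 0 Rad) ∧ ∀ σ ∈ ball (0 : ℂ) Rad,
      Dc σ ∈ closedBall (0 : ↥(T k) → 𝔸) (4 * C₂ * ε ^ 2) ∧
      Cf (ι (Y σ) - ι (H (Dc σ))) = Dc σ ∧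
      (∀ X' ∈ closedBall (0 : ↥(T k) → 𝔸) (4 * C₂ * ε ^ 2), Cf (ι (Y σ) - ι (H X')) = X' → X' = Dc σ) ∧
      ‖Dc σ‖ ≤ 4 * C₂ * ‖ι (Y σ)‖ ^ 2 :=
  landauCorrection_along_of_Q (Rk_pos hL k) (chartIter_analyticOnNhd_of_prop2 hL hT hG k U₀ hU hα hα3 hα2 h52)
    (norm_chartIter_le_MQ hL hT hG k U₀ hU hα hα3 hα2 h52) (chartIter_zero k) ι hι H hB₀ hH hq hRC hYd hY

end Printed


/-! ## §2 END-II's `hCr` for the printed `k`-fold average: the chart iterate is ⋆-EQUIVARIANT on its ball (S52 f2's (Q4)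
`QtΓ_conj` level by level, S47's ⋆-equivariance underneath), so `landauCf` maps HERMITIAN fields to HERMITIAN values -/

section Equivariant

variable {E : ℕ → Type*} [∀ j, NormedAddCommGroup (E j)] [∀ j, NormedSpace ℂ (E j)]

/-- **ITERATING EQUIVARIANT CHART MAPS** (generic twin of S57's `iterMap_facts_of_lt`): if every level map `F j`, `j < k`,
is analytic on `ball 0 r`, vanishes at `0`, is `M`-linearly bounded there, and is EQUIVARIANT there for a chain of
maps `κ j` (`F j (κ j B) = κ (j+1) (F j B)`, `‖B‖ < r`), then the `k`-fold composite is equivariant on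
`ball 0 (r ∕ Mᵏ)` (each intermediate iterate stays in `ball 0 r`). [folklore] -/
theorem iterMap_conj_of_lt (F : ∀ j, E j → E (j + 1)) (κ : ∀ j, E j → E j) {r M : ℝ} (hr : 0 < r) (hM : 1 ≤ M)
    (k : ℕ) (hF : ∀ j < k, AnalyticOnNhd ℂ (F j) (ball 0 r)) (h0 : ∀ j < k, F j 0 = 0)
    (hb : ∀ j < k, ∀ B ∈ ball (0 : E j) r, ‖F j B‖ ≤ M * ‖B‖)
    (heq : ∀ j < k, ∀ B ∈ ball (0 : E j) r, F j (κ j B) = κ (j + 1) (F j B)) :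
    ∀ B ∈ ball (0 : E 0) (r / M ^ k), iterMap F k (κ 0 B) = κ k (iterMap F k B) := by
  have hM0 : 0 < M := lt_of_lt_of_le one_pos hM
  induction k with
  | zero => intro B _; rfl
  | succ k ih =>
    intro B hB
    have hk : k < k + 1 := Nat.lt_succ_self k
    have hF' : ∀ j < k, AnalyticOnNhd ℂ (F j) (ball 0 r) := fun j hj => hF j (Nat.lt_succ_of_lt hj)
    have h0' : ∀ j < k, F j 0 = 0 := fun j hj => h0 j (Nat.lt_succ_of_lt hj)
    have hb' : ∀ j < k, ∀ B ∈ ball (0 : E j) r, ‖F j B‖ ≤ M * ‖B‖ := fun j hj => hb j (Nat.lt_succ_of_lt hj)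
    have heq' : ∀ j < k, ∀ B ∈ ball (0 : E j) r, F j (κ j B) = κ (j + 1) (F j B) :=
      fun j hj => heq j (Nat.lt_succ_of_lt hj)
    obtain ⟨-, -, ihb⟩ := iterMap_facts_of_lt F hr hM k hF' h0' hb'
    have hpow : 0 < M ^ k := pow_pos hM0 k
    have hsub : B ∈ ball (0 : E 0) (r / M ^ k) := by
      rw [mem_ball_zero_iff] at hB ⊢
      refine hB.trans_le (div_le_div_of_nonneg_left hr.le hpow ?_)
      rw [pow_succ]
      exact le_mul_of_one_le_right hpow.le hM
    have himg : iterMap F k B ∈ ball (0 : E k) r := by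
      have hB' := ihb B hsub
      rw [mem_ball_zero_iff] at hB ⊢
      calc ‖iterMap F k B‖ ≤ M ^ k * ‖B‖ := hB'
        _ < M ^ k * (r / M ^ (k + 1)) := mul_lt_mul_of_pos_left hB hpow
        _ = r / M := by rw [pow_succ]; field_simp
        _ ≤ r := div_le_self hr.le hM
    rw [iterMap_succ, iterMap_succ, ih hF' h0' hb' heq' B hsub, heq k hk _ himg]

end Equivariant

section Star

variable {d : ℕ} {𝔸 : Type*} [CStarAlgebra 𝔸] [Nontrivial 𝔸] {L : ℕ} {T : ℕ → Finset (ZdEdge d)}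

omit [Nontrivial 𝔸] in
/-- restriction commutes with the componentwise `⋆`. [folklore] -/
theorem restr_star {S S' : Finset (ZdEdge d)} (h : S' ⊆ S) (B : ↥S → 𝔸) : restr h (star B) = star (restr h B) :=
  funext fun _ => rfl

omit [Nontrivial 𝔸] in
/-- the pyramid's one-step chart map, coordinate by coordinate, IS S52's local chart average `QtΓ` of the restriction
(block locality, S57 f1's `Qtilde_ext_eq_of_subset`). [folklore] -/
theorem chartStep_apply_eq_QtΓ (hL : 0 < L) (hT : ∀ j, ∀ c ∈ T (j + 1), qppBonds L c ⊆ T j)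
    (V : ℕ → ZdEdge d → 𝔸ˣ) (j : ℕ) (B : ↥(T j) → 𝔸) (c : ↥(T (j + 1))) :
    chartStep L T V j B c = QtΓ L (V j) (c : ZdEdge d) (restr (hT j c c.2) B) :=
  Qtilde_ext_eq_of_subset hL (hT j c c.2) (V j) B

/-- **THE ONE-STEP CHART MAP IS ⋆-EQUIVARIANT ON ITS BALL** over a UNITARY, unit-bounded, loop-regular background
(S52 f2's (Q4) `QtΓ_conj` per coarse bond — S47's `star_Qtilde_gammaT` propagated over the ball by S51's germ route).
[folklore] -/
theorem chartStep_star (hL : 0 < L) (hT : ∀ j, ∀ c ∈ T (j + 1), qppBonds L c ⊆ T j) {V : ℕ → ZdEdge d → 𝔸ˣ}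
    {j : ℕ} (hVu : ∀ b, ((V j b : 𝔸ˣ) : 𝔸) ∈ unitary 𝔸) (hV : ∀ b, ‖((V j b : 𝔸ˣ) : 𝔸)‖ ≤ 1)
    (hV' : ∀ b, ‖(((V j b)⁻¹ : 𝔸ˣ) : 𝔸)‖ ≤ 1) {ε : ℝ} (hε0 : 0 ≤ ε) (hε : ε ≤ 1 / 8)
    (hW : ∀ c ∈ T (j + 1), ∀ x ∈ offAxis L c,
      ‖((loopW L (fun U : ZdEdge d → 𝔸ˣ => gammaT L U) (V j) c x : 𝔸ˣ) : 𝔸) - 1‖ ≤ ε) :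
    ∀ B ∈ ball (0 : ↥(T j) → 𝔸) (1 / (2816 * ((d : ℝ) + 1) * L)),
      chartStep L T V j (star B) = star (chartStep L T V j B) := by
  intro B hB
  funext c
  rw [Pi.star_apply, chartStep_apply_eq_QtΓ hL hT V j, chartStep_apply_eq_QtΓ hL hT V j, restr_star]
  have hB' : restr (hT j c c.2) B ∈ ball (0 : ↥(qppBonds L (c : ZdEdge d)) → 𝔸) (1 / (2816 * ((d : ℝ) + 1) * L)) := by
    rw [mem_ball_zero_iff] at hB ⊢
    exact (norm_restr_le _ B).trans_lt hB
  exact QtΓ_conj hL hVu hV hV' hε0 hε (hW c c.2) _ hB'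

variable (hL : 2 ≤ L) (hT : ∀ j, ∀ c ∈ T (j + 1), qppBonds L c ⊆ T j) (k : ℕ) (U₀ : ZdEdge d → 𝔸ˣ)
  (hU : ∀ b, U₀ b ∈ unitaryUnits 𝔸) {α₀ : ℝ} (hα : 0 < α₀) (hα3 : C0 d * α₀ ≤ 1 / 3) (hα2 : 2 * α₀ ≤ c2' d L)
  (h52 : pdev (Function.curry U₀) < α₀ * (((L : ℝ) ^ k)⁻¹) ^ 2)
include hL hT hU hα hα3 hα2 h52

omit hT in
/-- the averaged backgrounds `Ū₀ʲ`, `j ≤ k`, of a UNITARY-valued `U₀` with (52) are unitary-valued (S59 `mem_level` at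
`G = U(𝔸)`, `B7Prop2Explicit.avgClosed_unitaryUnits`). [folklore] -/
theorem avgIter_mem_unitary {j : ℕ} (hj : j ≤ k) (b : ZdEdge d) : ((avgIter L U₀ j b : 𝔸ˣ) : 𝔸) ∈ unitary 𝔸 := by
  rw [avgIter_eq_uncurry (lt_of_lt_of_le (by norm_num) hL)]
  exact mem_unitaryUnits.1 (mem_level hL (avgClosed_unitaryUnits d L) k U₀ hU hα hα3 hα2 h52 hj b)

/-- **THE `k`-FOLD CHART ITERATE OF THE PRINTED AVERAGE IS ⋆-EQUIVARIANT ON `ball 0 R_k`, FROM (52) + UNITARITY ALONE**: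
`chartIter … k (B⋆) = (chartIter … k B)⋆` for `‖B‖ < M⁻¹∕Mᵏ` — so HERMITIAN level-0 fields (print's `B′ = (1∕i) log V′`,
[B12] p. 265) are sent to HERMITIAN level-`k` values. [folklore] -/
theorem chartIter_star :
    ∀ B ∈ ball (0 : ↥(T 0) → 𝔸) (1 / (2816 * ((d : ℝ) + 1) * L) / (2816 * ((d : ℝ) + 1) * L) ^ k),
      chartIter L T (avgIter L U₀) k (star B) = star (chartIter L T (avgIter L U₀) k B) := by
  have hL0 : 0 < L := lt_of_lt_of_le (by norm_num) hL
  have hLr : (1 : ℝ) ≤ L := by exact_mod_cast hL0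
  have hM : (1 : ℝ) ≤ 2816 * ((d : ℝ) + 1) * L := by nlinarith [(Nat.cast_nonneg d : (0 : ℝ) ≤ d)]
  obtain ⟨hV, hV', hW⟩ := regime_of_prop2 hL (avgClosed_unitaryUnits d L) k U₀ hU hα hα3 hα2 h52
  refine iterMap_conj_of_lt (E := fun j => ↥(T j) → 𝔸) (chartStep L T (avgIter L U₀)) (fun _ B => star B)
    (by positivity) hM k ?_ (fun j _ => chartStep_zero j) ?_ ?_
  · intro j hj
    exact chartStep_analyticOnNhd (V := fun _ => avgIter L U₀ j) hL0 hT (fun _ => hV j hj) (fun _ => hV' j hj)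
      (by norm_num) (by norm_num) (fun _ c _ => hW j hj c) j
  · intro j hj B hB
    exact norm_chartStep_le (V := fun _ => avgIter L U₀ j) hL0 hT (fun _ => hV j hj) (fun _ => hV' j hj)
      (by norm_num) (by norm_num) (fun _ c _ => hW j hj c) j hB
  · intro j hj B hB
    exact chartStep_star hL0 hT (fun b => avgIter_mem_unitary hL k U₀ hU hα hα3 hα2 h52 hj.le b) (hV j hj)
      (hV' j hj) (by norm_num : (0 : ℝ) ≤ 1 / 32) (by norm_num) (fun c _ => hW j hj c) B hB

/-- **END-II's `hCr` FOR THE PRINTED `k`-FOLD AVERAGE, FROM (52) + UNITARITY ALONE**: the Landau-correction map read off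
the chart iterate sends the HERMITIAN level-0 fields (S40's `realSub` of the componentwise `⋆`, S52's `κΓ`-type real
form) into the HERMITIAN level-`k` fields — file 1's `landauCf_mem_realSub` on `chartIter_star`. (END-II's `𝓡𝒴′`∕`𝓡𝒳` are
abstract additive subgroups; THIS is the real structure the b12-typed average `exp(I•B′)·V` carries — matching it to the
LD line's skew-adjoint convention is the [dict] seat's one-line `I•` dictionary, displayed, not done here.) [folklore] -/
theorem cf_chartIter_mem_realSub :
    ∀ Z ∈ (realSub (starₗᵢ ℂ : (↥(T 0) → 𝔸) ≃ₗᵢ⋆[ℂ] (↥(T 0) → 𝔸))).toAddSubgroup,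
      landauCf (chartIter L T (avgIter L U₀) k) (1 / (2816 * ((d : ℝ) + 1) * L) / (2816 * ((d : ℝ) + 1) * L) ^ k) Z ∈
        (realSub (starₗᵢ ℂ : (↥(T k) → 𝔸) ≃ₗᵢ⋆[ℂ] (↥(T k) → 𝔸))).toAddSubgroup :=
  landauCf_mem_realSub (Rk_pos hL k)
    (chartIter_analyticOnNhd_of_prop2 hL hT (avgClosed_unitaryUnits d L) k U₀ hU hα hα3 hα2 h52)
    (fun B hB => chartIter_star hL hT k U₀ hU hα hα3 hα2 h52 B hB)

end Star

end Summit.QuantumFields.BalabanUV.T4Continuum.ShellMeasureLandauCorrectionIterate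

end
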